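import Mathlib.Analysis.Fourier.LpSpace
import Mathlib.Analysis.Distribution.AEEqOfIntegralContDiff
import Mathlib.MeasureTheory.Function.LpSeminorm.Monotonicity
import Mathlib.MeasureTheory.Function.LpSeminorm.TriangleInequality
import Literature.Analysis.Fourier.LpMultiplierProduct
import Literature.Analysis.Fourier.LpMultiplierSum
import Literature.Analysis.Fourier.MultiplierOpDeriv
import Literature.Analysis.Fourier.SobolevMultiplierBound
import HarnessLib

/-!
# Bounded symbols are `L²` Fourier multipliers (`L^∞ ⊆ M_2`) for the Bochner multiplier operator

For a bounded, entrywise measurable matrix symbol `M : V → Matrix κ ι ℂ` (`|M(ξ)_{ab}| ≤ C₀`)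
and a Schwartz test function `φ`, the multiplier operator `M(D)φ = 𝓕⁻¹(M · 𝓕φ)` of
`Literature/Analysis/Fourier/LpMultiplier.lean` (a Bochner inverse Fourier integral) satisfies
`‖M(D)φ‖_{L²} ≤ |κ| |ι| C₀ ‖φ‖_{L²}` (`eLpNorm_multiplierOp_two_le`) — the easy half of
"`M_2 = L^∞`" [Grafakos2014, Thm 2.5.10; BrennerThomeeWahlbin1975, Ch. 1 Thm 2.2], by
Plancherel. This is the step "the hyperbolicity of (1) shows that (5) is valid with `L¹`
replaced by `L²`" of [Rauch1986, Proof of Theorem p. 483] once the symbol is known to be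
bounded (`hasGradientLpBoundWith_two_of_bounded`).

The only non-formal point: `M · 𝓕φ ∈ L¹ ∩ L²` is not Schwartz, so Plancherel is needed for
the Bochner integral `𝓕⁻¹` of an `L¹ ∩ L²` function (`eLpNorm_fourierInv_eq`): Mathlib's
`L²` Fourier transform (`MeasureTheory.Lp.fourierTransformₗᵢ`, an isometry defined by density)
is identified with the Bochner `𝓕⁻¹` by testing both against smooth compactly supported
functions — through the tempered-distribution Fourier transform
(`Lp.fourierInv_toTemperedDistribution_eq`) on one side and the self-adjointness
`∫ 𝓕⁻u · g = ∫ u · 𝓕⁻g` (`integral_fourierInv_smul_eq_flip`) on the other — and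
`ae_eq_of_integral_contDiff_smul_eq`. Vector values `ℂ^ι` (sup norm, not a Hilbert space) are
handled componentwise, whence the constant `|κ| |ι|`.

## References

* [Rauch1986] J. Rauch, Comm. Math. Phys. 106 (1986) 481–484, p. 483.
* [Grafakos2014] L. Grafakos, *Classical Fourier Analysis*, 3rd ed. (2014), Thm 2.5.10, §2.5.5.
* [BrennerThomeeWahlbin1975] P. Brenner, V. Thomée, L. B. Wahlbin, LNM 434 (1975), Ch. 1 Thm 2.2.
-/

noncomputable section

open MeasureTheory FourierTransform
open scoped SchwartzMap ENNReal NNReal ContDiff RealInnerProductSpace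

namespace Literature.Analysis.Fourier

variable {V : Type*} [NormedAddCommGroup V] [InnerProductSpace ℝ V] [FiniteDimensional ℝ V]
  [MeasurableSpace V] [BorelSpace V] {ι κ : Type*} [Fintype ι] [Fintype κ]

/-! ### Plancherel for the Bochner inverse Fourier integral of an `L¹ ∩ L²` function -/

/-- Self-adjointness of `𝓕⁻` for plain integrable functions:
`∫ 𝓕⁻u(x) • g(x) dx = ∫ u(ξ) • 𝓕⁻g(ξ) dξ`. [folklore] -/
theorem integral_fourierInv_smul_eq_flip {F : Type*} [NormedAddCommGroup F] [NormedSpace ℂ F]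
    [CompleteSpace F] {u : V → ℂ} {g : V → F} (hu : Integrable u) (hg : Integrable g) :
    ∫ x, 𝓕⁻ u x • g x = ∫ ξ, u ξ • 𝓕⁻ g ξ := by
  have hL : Continuous fun p : V × V => (-innerₗ V) p.1 p.2 := by
    simp only [LinearMap.neg_apply, innerₗ_apply_apply]
    exact continuous_inner.neg
  have h := VectorFourier.integral_fourierIntegral_smul_eq_flip (L := -innerₗ V) (μ := volume)
    (ν := volume) Real.continuous_fourierChar hL hu hg
  have hflip : (-innerₗ V).flip = -innerₗ V := by
    ext x y
    simp [real_inner_comm]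
  rw [hflip] at h
  exact h

/-- `‖𝓕g‖_{L²} = ‖g‖_{L²}` for a scalar Schwartz function, in terms of `eLpNorm` (Plancherel for
Schwartz functions, from Mathlib's `SchwartzMap.norm_fourier_toL2_eq`). [folklore] -/
theorem eLpNorm_fourier_schwartz_eq (g : 𝓢(V, ℂ)) :
    eLpNorm (𝓕 (⇑g)) 2 volume = eLpNorm (⇑g) 2 volume := by
  have h := SchwartzMap.norm_fourier_toL2_eq g
  rw [SchwartzMap.norm_toLp, SchwartzMap.norm_toLp,
    ENNReal.toReal_eq_toReal_iff' ((𝓕 g).eLpNorm_lt_top 2 volume).ne (g.eLpNorm_lt_top 2 volume).ne]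
    at h
  rw [← SchwartzMap.fourier_coe]
  exact h

omit [FiniteDimensional ℝ V] [MeasurableSpace V] [BorelSpace V] in
/-- A smooth compactly supported real function, complexified, as a Schwartz map. [folklore] -/
theorem exists_schwartz_coe_eq {θ : V → ℝ} (hθ : ContDiff ℝ ∞ θ) (hc : HasCompactSupport θ) :
    ∃ θS : 𝓢(V, ℂ), ∀ x, θS x = (θ x : ℂ) := by
  have h1 : ContDiff ℝ ∞ fun x => (θ x : ℂ) := Complex.ofRealCLM.contDiff.comp hθ
  have h2 : HasCompactSupport fun x => (θ x : ℂ) := hc.comp_left Complex.ofReal_zero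
  exact ⟨h2.toSchwartzMap h1, fun x => rfl⟩

/-- **Plancherel for the Bochner inverse Fourier integral**: for `u ∈ L¹ ∩ L²(V; ℂ)`,
`‖𝓕⁻u‖_{L²} = ‖u‖_{L²}`; in particular `𝓕⁻u ∈ L²`. The Bochner integral `𝓕⁻u` agrees a.e.
with the `L²`-Fourier inverse of `u` (an isometry), as both induce the tempered distribution
`𝓕⁻¹` of `u`. [cite: Grafakos2014, Thm 2.5.10] -/
theorem eLpNorm_fourierInv_eq {u : V → ℂ} (hu1 : Integrable u) (hu2 : MemLp u 2 volume) :
    eLpNorm (𝓕⁻ u) 2 volume = eLpNorm u 2 volume := by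
  set uL : Lp ℂ 2 (volume : Measure V) := hu2.toLp u with huL
  have huLae : (uL : V → ℂ) =ᵐ[volume] u := hu2.coeFn_toLp
  set wL : Lp ℂ 2 (volume : Measure V) := 𝓕⁻ uL with hwL
  -- Step A: the `L²` inverse transform agrees a.e. with the Bochner integral
  have hae : (wL : V → ℂ) =ᵐ[volume] 𝓕⁻ u := by
    refine ae_eq_of_integral_contDiff_smul_eq ((Lp.memLp wL).locallyIntegrable (by norm_num))
      (continuous_fourierInv_of_integrable hu1).locallyIntegrable fun θ hθ hθc => ?_
    obtain ⟨θS, hθS⟩ := exists_schwartz_coe_eq hθ hθc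
    have hsm : ∀ (f : V → ℂ) (x : V), θ x • f x = θS x • f x := fun f x => by
      rw [hθS, Complex.coe_smul]
    simp_rw [hsm]
    calc ∫ x, θS x • wL x = Lp.toTemperedDistribution wL θS :=
          (Lp.toTemperedDistribution_apply wL θS).symm
      _ = (𝓕⁻ (Lp.toTemperedDistribution uL)) θS := by
          rw [hwL, Lp.fourierInv_toTemperedDistribution_eq uL]
      _ = ∫ x, (𝓕⁻ θS) x • uL x := by
          rw [TemperedDistribution.fourierInv_apply, Lp.toTemperedDistribution_apply]
      _ = ∫ x, 𝓕⁻ (⇑θS) x • u x := by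
          refine integral_congr_ae ?_
          filter_upwards [huLae] with x hx
          rw [hx, SchwartzMap.fourierInv_coe]
      _ = ∫ x, θS x • 𝓕⁻ u x := integral_fourierInv_smul_eq_flip θS.integrable hu1
  -- Step B: norms
  calc eLpNorm (𝓕⁻ u) 2 volume = eLpNorm (wL : V → ℂ) 2 volume := eLpNorm_congr_ae hae.symm
    _ = ‖wL‖ₑ := (Lp.enorm_def wL).symm
    _ = ‖uL‖ₑ := by
        rw [← ofReal_norm, ← ofReal_norm]
        congr 1
        exact (Lp.fourierTransformₗᵢ V ℂ).symm.norm_map uL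
    _ = eLpNorm (uL : V → ℂ) 2 volume := Lp.enorm_def uL
    _ = eLpNorm u 2 volume := eLpNorm_congr_ae huLae


/-! ### Linearity of `M(D)` in the test function -/

/-- `𝓕⁻ (c • F) = c • 𝓕⁻ F` for bare functions (no integrability needed). [folklore] -/
theorem fourierInv_const_smul' {E : Type*} [NormedAddCommGroup E] [NormedSpace ℂ E]
    (c : ℂ) (F : V → E) : 𝓕⁻ (c • F) = c • 𝓕⁻ F := by
  funext x
  simp only [Real.fourierInv_eq, Pi.smul_apply, smul_comm _ c, integral_smul]

/-- `M(D)(f + g) = M(D)f + M(D)g` for Schwartz `f, g` and a bounded measurable symbol (the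
Bochner `𝓕⁻` is additive on integrable functions). [folklore] -/
theorem multiplierOp_schwartz_add {M : V → Matrix κ ι ℂ} (hM : ∀ a b, Measurable fun ξ => M ξ a b)
    {C₀ : ℝ} (hC0 : 0 ≤ C₀) (hC : ∀ ξ a b, ‖M ξ a b‖ ≤ C₀) (f g : 𝓢(V, ι → ℂ)) (x : V) :
    multiplierOp M (⇑(f + g)) x = multiplierOp M ⇑f x + multiplierOp M ⇑g x := by
  have hF : (fun ξ => (M ξ).mulVec (𝓕 (⇑(f + g)) ξ)) =
      (fun ξ => (M ξ).mulVec (𝓕 (⇑f) ξ)) + fun ξ => (M ξ).mulVec (𝓕 (⇑g) ξ) := by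
    funext ξ
    rw [Pi.add_apply, ← SchwartzMap.fourier_coe, fourier_add f g, add_apply,
      Matrix.mulVec_add, SchwartzMap.fourier_coe, SchwartzMap.fourier_coe]
  rw [multiplierOp_apply, hF, fourierInv_add' (integrable_mulVec_fourier hM hC0 hC f)
    (integrable_mulVec_fourier hM hC0 hC g)]
  rfl

/-- `M(D)(c f) = c M(D)f` for Schwartz `f`. [folklore] -/
theorem multiplierOp_schwartz_smul (M : V → Matrix κ ι ℂ) (c : ℂ) (f : 𝓢(V, ι → ℂ)) (x : V) :
    multiplierOp M (⇑(c • f)) x = c • multiplierOp M ⇑f x := by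
  have hF : (fun ξ => (M ξ).mulVec (𝓕 (⇑(c • f)) ξ)) = c • fun ξ => (M ξ).mulVec (𝓕 (⇑f) ξ) := by
    funext ξ
    rw [Pi.smul_apply, ← SchwartzMap.fourier_coe, fourier_smul c f, smul_apply, Matrix.mulVec_smul,
      SchwartzMap.fourier_coe]
  rw [multiplierOp_apply, hF, fourierInv_const_smul']
  rfl

/-! ### The `L²` bound for `M(D)` -/

/-- Sup norm is below the `ℓ¹` norm: `‖w‖_∞ ≤ Σₐ |wₐ|`. [folklore] -/
theorem norm_le_sum_norm_apply (w : κ → ℂ) : ‖w‖ ≤ ∑ a, ‖w a‖ :=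
  (pi_norm_le_iff_of_nonneg (Finset.sum_nonneg fun _ _ => norm_nonneg _)).2 fun a =>
    Finset.single_le_sum (f := fun a => ‖w a‖) (fun _ _ => norm_nonneg _) (Finset.mem_univ a)

/-- `‖F‖_{Lᵖ(sup norm)} ≤ Σₐ ‖Fₐ‖_{Lᵖ}` for `ℂ^κ`-valued `F`, `1 ≤ p`. [folklore] -/
theorem eLpNorm_pi_le_sum {F : V → κ → ℂ} (hF : ∀ a, AEStronglyMeasurable (fun x => F x a) volume)
    {p : ℝ≥0∞} (hp : 1 ≤ p) :
    eLpNorm F p volume ≤ ∑ a, eLpNorm (fun x => F x a) p volume := by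
  have h1 : eLpNorm F p volume ≤ eLpNorm (∑ a, fun x => ‖F x a‖) p volume := by
    refine eLpNorm_mono fun x => ?_
    rw [Finset.sum_apply, Real.norm_eq_abs,
      abs_of_nonneg (Finset.sum_nonneg fun _ _ => norm_nonneg _)]
    exact norm_le_sum_norm_apply (F x)
  refine h1.trans ((eLpNorm_sum_le (fun a _ => (hF a).norm) hp).trans (le_of_eq ?_))
  exact Finset.sum_congr rfl fun a _ => eLpNorm_norm _

/-- Components pass through the Bochner inverse Fourier integral: `(𝓕⁻h)(x)ₐ = 𝓕⁻(hₐ)(x)` for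
integrable `h : V → ℂ^κ`. [folklore] -/
theorem fourierInv_apply_apply {h : V → κ → ℂ} (hh : Integrable h) (x : V) (a : κ) :
    𝓕⁻ h x a = 𝓕⁻ (fun ξ => h ξ a) x := by
  rw [Real.fourierInv_eq_fourier_neg, Real.fourierInv_eq_fourier_neg]
  exact fourier_apply_apply hh (-x) a

/-- **`‖M(D)φ‖_{L²} ≤ |κ| |ι| C₀ ‖φ‖_{L²}`** for a Schwartz test function `φ` and an entrywise
measurable symbol with `|M(ξ)_{ab}| ≤ C₀`: bounded symbols are `L²` multipliers (Plancherel;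
componentwise in the sup norms). [cite: Grafakos2014, Thm 2.5.10] -/
theorem eLpNorm_multiplierOp_two_le {M : V → Matrix κ ι ℂ} (hM : ∀ a b, Measurable fun ξ => M ξ a b)
    {C₀ : ℝ≥0} (hC : ∀ ξ a b, ‖M ξ a b‖ ≤ C₀) (φ : 𝓢(V, ι → ℂ)) :
    eLpNorm (multiplierOp M ⇑φ) 2 volume ≤
      (Fintype.card κ * (Fintype.card ι * C₀) : ℝ≥0) * eLpNorm (⇑φ) 2 volume := by
  have hC0 : (0 : ℝ) ≤ C₀ := C₀.coe_nonneg
  -- the Fourier-side function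
  set h : V → κ → ℂ := fun ξ => (M ξ).mulVec (𝓕 (⇑φ) ξ) with hh
  have hint : Integrable h := integrable_mulVec_fourier hM hC0 hC φ
  have hmeas : Measurable h := by
    rw [hh, ← SchwartzMap.fourier_coe]
    exact measurable_mulVec hM (𝓕 φ).continuous.measurable
  -- scalar components of `φ` and Plancherel for them
  set φb : ι → 𝓢(V, ℂ) := fun b =>
    SchwartzMap.postcompCLM (ContinuousLinearMap.proj (R := ℂ) (φ := fun _ : ι => ℂ) b) φ with hφb
  have hφb_coe : ∀ b x, φb b x = φ x b := fun b x => rfl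
  have hFb : ∀ b ξ, 𝓕 (⇑φ) ξ b = 𝓕 (⇑(φb b)) ξ := fun b ξ => by
    rw [fourier_apply_apply φ.integrable]
    rfl
  -- the majorant `G(ξ) = Σ_b |𝓕φ_b(ξ)|`
  set G : V → ℝ := fun ξ => ∑ b, ‖𝓕 (⇑(φb b)) ξ‖ with hG
  have hGcont : ∀ b, Continuous fun ξ => 𝓕 (⇑(φb b)) ξ := fun b => by
    rw [← SchwartzMap.fourier_coe]; exact (𝓕 (φb b)).continuous
  have hG2 : eLpNorm G 2 volume ≤ Fintype.card ι * eLpNorm (⇑φ) 2 volume := by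
    have h1 : eLpNorm G 2 volume ≤ ∑ b, eLpNorm (fun ξ => ‖𝓕 (⇑(φb b)) ξ‖) 2 volume := by
      have : G = ∑ b, fun ξ => ‖𝓕 (⇑(φb b)) ξ‖ := by
        funext ξ; simp [hG]
      rw [this]
      exact eLpNorm_sum_le (fun b _ => (hGcont b).norm.aestronglyMeasurable) one_le_two
    refine h1.trans ?_
    calc ∑ b, eLpNorm (fun ξ => ‖𝓕 (⇑(φb b)) ξ‖) 2 volume
        = ∑ b, eLpNorm (⇑(φb b)) 2 volume := Finset.sum_congr rfl fun b _ => by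
            rw [eLpNorm_norm, eLpNorm_fourier_schwartz_eq]
      _ ≤ ∑ _b : ι, eLpNorm (⇑φ) 2 volume := Finset.sum_le_sum fun b _ =>
            eLpNorm_mono fun x => by rw [hφb_coe]; exact norm_le_pi_norm (φ x) b
      _ = Fintype.card ι * eLpNorm (⇑φ) 2 volume := by
            rw [Finset.sum_const, Finset.card_univ, nsmul_eq_mul]
  -- each component of `M(D)φ` is the inverse transform of an `L¹ ∩ L²` function
  have hcomp : ∀ a, eLpNorm (fun x => multiplierOp M ⇑φ x a) 2 volume ≤
      C₀ * (Fintype.card ι * eLpNorm (⇑φ) 2 volume) := by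
    intro a
    set ua : V → ℂ := fun ξ => h ξ a with hua
    have hua_int : Integrable ua :=
      (ContinuousLinearMap.proj (R := ℂ) (φ := fun _ : κ => ℂ) a).integrable_comp hint
    have hua_meas : AEStronglyMeasurable ua volume := hua_int.aestronglyMeasurable
    have hua_le : ∀ ξ, ‖ua ξ‖ ≤ C₀ * ‖G ξ‖ := fun ξ => by
      have hGn : ‖G ξ‖ = ∑ b, ‖𝓕 (⇑(φb b)) ξ‖ := by
        rw [Real.norm_eq_abs, abs_of_nonneg (Finset.sum_nonneg fun _ _ => norm_nonneg _)]
      rw [hGn, Finset.mul_sum]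
      calc ‖ua ξ‖ = ‖∑ b, M ξ a b * 𝓕 (⇑φ) ξ b‖ := rfl
        _ ≤ ∑ b, ‖M ξ a b * 𝓕 (⇑φ) ξ b‖ := norm_sum_le _ _
        _ ≤ ∑ b, C₀ * ‖𝓕 (⇑(φb b)) ξ‖ := Finset.sum_le_sum fun b _ => by
            rw [norm_mul, hFb]
            exact mul_le_mul_of_nonneg_right (hC ξ a b) (norm_nonneg _)
    have hua_mem : MemLp ua 2 volume := by
      refine MemLp.of_le_mul (c := Fintype.card ι * C₀) ((𝓕 φ).memLp 2 volume) hua_meas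
        (Filter.Eventually.of_forall fun ξ => ?_)
      calc ‖ua ξ‖ ≤ ‖h ξ‖ := norm_le_pi_norm (h ξ) a
        _ ≤ Fintype.card ι * C₀ * ‖𝓕 (⇑φ) ξ‖ := norm_mulVec_apply_le hC0 hC _ ξ
        _ = Fintype.card ι * C₀ * ‖(𝓕 φ : 𝓢(V, ι → ℂ)) ξ‖ := by rw [SchwartzMap.fourier_coe]
    have hop : (fun x => multiplierOp M ⇑φ x a) = 𝓕⁻ ua := by
      funext x
      rw [multiplierOp_apply]
      exact fourierInv_apply_apply hint x a
    rw [hop, eLpNorm_fourierInv_eq hua_int hua_mem]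
    have h1 : eLpNorm ua 2 volume ≤ C₀ * eLpNorm G 2 volume := by
      have := eLpNorm_le_nnreal_smul_eLpNorm_of_ae_le_mul
        (Filter.Eventually.of_forall fun ξ => show ‖ua ξ‖₊ ≤ C₀ * ‖G ξ‖₊ from hua_le ξ) 2
        (μ := volume)
      simpa [ENNReal.smul_def, smul_eq_mul] using this
    exact h1.trans (mul_le_mul_right hG2 _)
  -- sum over the components
  have hmeas_comp : ∀ a, AEStronglyMeasurable (fun x => multiplierOp M ⇑φ x a) volume := fun a =>
    (continuous_apply a |>.comp (continuous_fourierInv_of_integrable hint)).aestronglyMeasurable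
  refine (eLpNorm_pi_le_sum hmeas_comp one_le_two).trans ?_
  calc ∑ a, eLpNorm (fun x => multiplierOp M ⇑φ x a) 2 volume
      ≤ ∑ _a : κ, C₀ * (Fintype.card ι * eLpNorm (⇑φ) 2 volume) := Finset.sum_le_sum fun a _ => hcomp a
    _ = (Fintype.card κ * (Fintype.card ι * C₀) : ℝ≥0) * eLpNorm (⇑φ) 2 volume := by
        rw [Finset.sum_const, Finset.card_univ, nsmul_eq_mul]
        push_cast
        ring

/-- Hence a bounded, entrywise measurable symbol has the `Ẇ^{1,2}` bound
(`HasGradientLpBoundWith 2`) with constant `|κ| |ι| C₀` on `ℝᵈ`: "(5) is valid with `L¹`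
replaced by `L²`" once `sup_ξ |M(ξ)| < ∞`.
[cite: Rauch1986, Proof of Theorem p. 483; Grafakos2014, Thm 2.5.10] -/
theorem hasGradientLpBoundWith_two_of_bounded {d : ℕ} {k k' : Type*} [Fintype k] [Fintype k']
    {M : EuclideanSpace ℝ (Fin d) → Matrix k' k ℂ} (hM : ∀ a b, Measurable fun ξ => M ξ a b)
    {C₀ : ℝ≥0} (hC : ∀ ξ a b, ‖M ξ a b‖ ≤ C₀) :
    HasGradientLpBoundWith 2 (Fintype.card k' * (Fintype.card k * C₀)) M := by
  intro φ hφ hc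
  have hC0 : (0 : ℝ) ≤ C₀ := C₀.coe_nonneg
  -- `∂ⱼφ` as a Schwartz map
  have hS : ∀ j, ∃ g : 𝓢(EuclideanSpace ℝ (Fin d), k → ℂ), ⇑g = partialDeriv j φ := by
    intro j
    have h1 : ContDiff ℝ ∞ (partialDeriv j φ) := by
      have := hφ.fderiv_right (m := ∞) (by norm_cast)
      exact this.clm_apply contDiff_const
    have h2 : HasCompactSupport (partialDeriv j φ) :=
      (hc.fderiv ℝ).mono fun x hx => by
        simp only [Function.mem_support, ne_eq, partialDeriv] at hx ⊢
        intro h0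
        exact hx (by rw [h0, _root_.zero_apply])
    exact ⟨h2.toSchwartzMap h1, rfl⟩
  refine ⟨fun j => ?_, ?_⟩
  · obtain ⟨g, hg⟩ := hS j
    rw [← hg]
    exact integrable_mulVec_fourier hM hC0 hC g
  · rw [Finset.mul_sum]
    refine Finset.sum_le_sum fun j _ => ?_
    obtain ⟨g, hg⟩ := hS j
    rw [← hg]
    exact eLpNorm_multiplierOp_two_le hM hC g

end Literature.Analysis.Fourier

end
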